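import Literature.AlgebraicGeometry.FundamentalGroup.ProjectiveSpace
import Literature.AlgebraicGeometry.Motives.IntegralProjectiveSpace
import Literature.AlgebraicGeometry.Motives.VarietiesProjectiveSpaceProofs
import Literature.AlgebraicGeometry.Motives.SegreEmbedding
import Mathlib.AlgebraicGeometry.Morphisms.ClosedImmersion
import Mathlib.Algebra.MvPolynomial.Equiv
import Mathlib.RingTheory.Polynomial.Basic
import HarnessLib

/-!
# The pencil of hyperplanes `x_{r+2} = t · x_{r+1}` in `ℙ^{r+2}_k` (towards SGA 1 X 2.11 for `ℙ^r`)

Topic: `Literature/AlgebraicGeometry/FundamentalGroup`. First of the proof files for the named fact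
`Literature.AlgebraicGeometry.FundamentalGroup.EtaleCoverHyperplaneSectionConnected`
(`FundamentalGroup/ProjectiveSpace.lean`; SGA 1, Exp. X, Cor. 2.11 for projective space): the
hyperplane section `Y ×_{ℙ^{r+2}} ℙ^{r+1}` of a connected finite étale cover `Y → ℙ^{r+2}_k`
(`k` algebraically closed) along the coordinate hyperplane `ProjectiveSpace.hyperplaneEmb k (r + 1)`
is connected. The Lean proof degenerates a moving hyperplane to the coordinate one and applies
Zariski's connectedness theorem (theorem on formal functions) to the total space of the pencil;
this file builds the pencil.

Let `A = k[t]` and `P_A = ℙ^{r+1}_A = Proj A[x₀, …, x_{r+1}]`. The graded `k`-algebra map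
`Ψ : k[x₀, …, x_{r+2}] → A[x₀, …, x_{r+1}]`, `x_j ↦ x_j` (`j ≤ r + 1`), `x_{r+2} ↦ t · x_{r+1}`
(`HyperplanePencil.graded`) defines `ψ = Proj Ψ : P_A → ℙ^{r+2}_k` (`HyperplanePencil.map`), the
total space of the pencil of hyperplanes `H_t = V₊(x_{r+2} - t x_{r+1})` through the base locus
`V₊(x_{r+1}, x_{r+2})`:

* `isClosedImmersion_projMap_of_surjective` — `Proj` of a SURJECTIVE graded ring homomorphism is a
  closed immersion (Hartshorne II Ex. 3.12 (a); EGA II 2.9.2): on the chart `D₊(s)` it is `Spec`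
  of the surjection `(A_{(s)})₀ → (B_{(f s)})₀` (Mathlib `Proj.awayι_comp_map`).
* `HyperplanePencil.map_eq_comp` — `ψ` factors as the closed immersion
  `φ_A = Proj Ψ_A : P_A → ℙ^{r+2}_A` (`Ψ_A` the `A`-linear substitution, a graded surjection)
  followed by the base-change projection `ℙ^{r+2}_A → ℙ^{r+2}_k` (`Motives.ProjBaseChangeRing`).
* `HyperplanePencil.specialFibre_comp_map` — on the fibre `t = 0`,
  `ρ = Proj (A[x] → k[x], t ↦ 0) : ℙ^{r+1}_k → P_A` composed with `ψ` is the coordinate hyperplane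
  embedding `ProjectiveSpace.hyperplaneEmb k (r + 1)`; and `isPullback_specialFibre` — the square
  `(ρ, ℙ^{r+1}_k → Spec k, P_A → Spec A, Spec k → Spec A)` is cartesian (from the flat base change
  `k → A` of `Motives.ProjBaseChangeRing.isPullback_projMap` by pasting with the identity square).
* `HyperplanePencil.isOpenImmersion_awayι_comp_map`, `opensRange_awayι_comp_map` — over the chart
  `D₊(x_{r+1}) ⊆ ℙ^{r+2}_k` the pencil is an ISOMORPHISM: `D₊(x_{r+1}) ⊆ P_A` maps isomorphically
  onto `D₊(x_{r+1}) ⊆ ℙ^{r+2}_k` (in affine coordinates `(y, t) ↦ (y, x_{r+2}/x_{r+1} = t)`; the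
  ring map `(k[x]_{(x_{r+1})})₀ → (A[x]_{(x_{r+1})})₀` is `k[y₀, …, y_r, y_{r+2}] ≅ k[t][y₀, …, y_r]`,
  `away_map_bijective`).

Everything is proved; no named facts are introduced.

## References

* A. Grothendieck, M. Raynaud, SGA 1 (LNM 224 / SMF 2003, arXiv:math/0206203): Exp. X Lemme 2.10,
  Cor. 2.11 (éd. arXiv p. 152); Exp. XI Prop. 1.1. [SGA1]
* R. Hartshorne, *Algebraic Geometry*, GTM 52 (1977): II Ex. 3.12 (a), II Prop. 2.5 (b).
  [Hartshorne1977]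
* A. Grothendieck, EGA II, Prop. 2.9.2 (closed immersions of `Proj` from graded surjections).
-/

noncomputable section

open CategoryTheory CategoryTheory.Limits AlgebraicGeometry TopologicalSpace MvPolynomial
  HomogeneousLocalization

namespace Literature.AlgebraicGeometry.FundamentalGroup

universe u

/-! ## `Proj` of a graded surjection is a closed immersion -/

section ProjMapClosedImmersion

variable {A B σ τ : Type u} [CommRing A] [SetLike σ A] [AddSubgroupClass σ A]
  [CommRing B] [SetLike τ B] [AddSubgroupClass τ B]
  {𝒜 : ℕ → σ} {ℬ : ℕ → τ} [GradedRing 𝒜] [GradedRing ℬ]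
  (f : 𝒜 →+*ᵍ ℬ) (hf : HomogeneousIdeal.irrelevant ℬ ≤ (HomogeneousIdeal.irrelevant 𝒜).map f)

/-- For a surjective graded ring homomorphism `f : A → B` and a homogeneous `s ∈ A` of positive
degree, the induced map of degree-zero localizations `(A_s)₀ → (B_{f s})₀` (Mathlib
`HomogeneousLocalization.Away.map`) is surjective: a homogeneous `b ∈ B` of degree `n · deg s` is
the image of the degree-`n · deg s` component of any preimage. [folklore] -/
theorem away_map_surjective (hsurj : Function.Surjective f) {d : ℕ} {s : A} (hs : s ∈ 𝒜 d) :
    Function.Surjective (Away.map f s) := by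
  classical
  intro y
  obtain ⟨n, b, hb, rfl⟩ := Away.mk_surjective ℬ (f.2 hs) y
  obtain ⟨a, ha⟩ := hsurj b
  refine ⟨Away.mk 𝒜 hs n (DirectSum.decompose 𝒜 a (n • d)) (SetLike.coe_mem _), ?_⟩
  rw [Away.map_mk]
  apply val_injective
  simp only [Away.val_mk]
  congr 1
  rw [GradedRingHom.map_directSumDecompose, ha, DirectSum.decompose_of_mem_same ℬ hb]

include hf in
/-- **`Proj` of a surjective graded ring homomorphism is a closed immersion** (Hartshorne II
Ex. 3.12 (a): for a graded surjection `φ : S → T`, `Proj T → Proj S` is a closed immersion;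
EGA II 2.9.2). Proof: being a closed immersion is local on the target; over the chart
`D₊(s) = Spec (A_s)₀` of `Proj A` the morphism is `Spec` of `(A_s)₀ → (B_{φ s})₀` (Mathlib
`Proj.awayι_comp_map`, a cartesian square), which is surjective (`away_map_surjective`).
[cite: Hartshorne1977, II Ex. 3.12 (a)] -/
theorem isClosedImmersion_projMap_of_surjective (hsurj : Function.Surjective f) :
    IsClosedImmersion (Proj.map f hf) := by
  refine IsZariskiLocalAtTarget.of_openCover (P := @IsClosedImmersion)
    (Proj.affineOpenCover 𝒜).openCover fun i ↦ ?_
  have hd : 0 < (i.1 : ℕ) := i.1.2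
  have hs : (i.2 : A) ∈ 𝒜 i.1 := i.2.2
  have hopen : IsPullback (Spec.map (CommRingCat.ofHom (Away.map f (i.2 : A))))
      (Proj.awayι ℬ (f (i.2 : A)) (f.2 hs) hd) (Proj.awayι 𝒜 (i.2 : A) hs hd) (Proj.map f hf) :=
    IsOpenImmersion.isPullback _ _ _ _ (Proj.awayι_comp_map _ _ hd _ hs)
      (by rw [Proj.opensRange_awayι, Proj.opensRange_awayι, Proj.map_preimage_basicOpen])
  have h2 : IsClosedImmersion
      (hopen.flip.isoPullback.inv ≫ Spec.map (CommRingCat.ofHom (Away.map f (i.2 : A)))) := by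
    have := IsClosedImmersion.spec_of_surjective
      (CommRingCat.ofHom (Away.map f (i.2 : A))) (away_map_surjective f hsurj hs)
    infer_instance
  have e : hopen.flip.isoPullback.inv ≫ Spec.map (CommRingCat.ofHom (Away.map f (i.2 : A))) =
      pullback.snd (Proj.map f hf) (Proj.awayι 𝒜 (i.2 : A) hs hd) := by
    rw [Iso.inv_comp_eq]
    exact hopen.flip.isoPullback_hom_snd.symm
  rw [e] at h2
  exact h2

/-- `Proj.map` only depends on the graded homomorphism (congruence in the map, absorbing the
proof argument). [folklore] -/
theorem projMap_congr {f g : 𝒜 →+*ᵍ ℬ} (h : f = g)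
    (hf : HomogeneousIdeal.irrelevant ℬ ≤ (HomogeneousIdeal.irrelevant 𝒜).map f)
    (hg : HomogeneousIdeal.irrelevant ℬ ≤ (HomogeneousIdeal.irrelevant 𝒜).map g) :
    Proj.map f hf = Proj.map g hg := by
  subst h
  rfl

end ProjMapClosedImmersion

/-! ## Transport of `(A_s)₀` along `s = s'` -/

section AwayCongr

variable {A σ : Type u} [CommRing A] [SetLike σ A] [AddSubgroupClass σ A]
  (𝒜 : ℕ → σ) [GradedRing 𝒜]

/-- The identification `(A_s)₀ → (A_{s'})₀` for `s = s'` (Mathlib `HomogeneousLocalization.mapId`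
along `powers s ≤ powers s'`). [folklore] -/
abbrev awayCongr {s s' : A} (h : s = s') : Away 𝒜 s →+* Away 𝒜 s' :=
  HomogeneousLocalization.mapId 𝒜 (le_of_eq (by rw [h]))

/-- `awayCongr` is bijective. [folklore] -/
theorem awayCongr_bijective {s s' : A} (h : s = s') : Function.Bijective (awayCongr 𝒜 h) := by
  subst h
  change Function.Bijective (HomogeneousLocalization.map (GradedRingHom.id 𝒜) _)
  rw [HomogeneousLocalization.map_id]
  exact Function.bijective_id

/-- `awayCongr` on fractions `x / s ^ n`. [folklore] -/
theorem val_awayCongr_mk {s s' : A} (h : s = s') {d : ℕ} (hs : s ∈ 𝒜 d) (n : ℕ) (x : A)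
    (hx : x ∈ 𝒜 (n • d)) :
    (awayCongr 𝒜 h (Away.mk 𝒜 hs n x hx)).val = Localization.mk x ⟨s' ^ n, by use n⟩ := by
  subst h
  rfl

end AwayCongr

/-! ## The pencil -/

attribute [local instance] MvPolynomial.gradedAlgebra Motives.ProjBaseChange.algebraBase

namespace HyperplanePencil

variable (k : Type u) [Field k] (r : ℕ)

/-- The grading of `k[x₀, …, x_{r+2}]` (ambient `ℙ^{r+2}_k`). -/
local notation "𝒜k" => MvPolynomial.homogeneousSubmodule (Fin (r + 3)) k
/-- The grading of `k[x₀, …, x_{r+1}]` (the hyperplane `ℙ^{r+1}_k`). -/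
local notation "𝒜k'" => MvPolynomial.homogeneousSubmodule (Fin (r + 2)) k
/-- The grading of `A[x₀, …, x_{r+2}]`, `A = k[t]` (`ℙ^{r+2}_A`). -/
local notation "𝒜A'" => MvPolynomial.homogeneousSubmodule (Fin (r + 3)) (Polynomial k)
/-- The grading of `A[x₀, …, x_{r+1}]`, `A = k[t]` (the total space `P_A = ℙ^{r+1}_A`). -/
local notation "𝒜A" => MvPolynomial.homogeneousSubmodule (Fin (r + 2)) (Polynomial k)

/-- The substitution `x_j ↦ x_j` (`j ≤ r + 1`), `x_{r+2} ↦ t · x_{r+1}` with values in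
`A[x₀, …, x_{r+1}]`, `A = k[t]`. [folklore] -/
def subst : Fin (r + 3) → MvPolynomial (Fin (r + 2)) (Polynomial k) :=
  Fin.lastCases (C Polynomial.X * X (Fin.last (r + 1))) fun j => X j

/-- `subst` on `x_j`, `j ≤ r + 1`. [folklore] -/
@[simp]
theorem subst_castSucc (j : Fin (r + 2)) : subst k r (Fin.castSucc j) = X j :=
  Fin.lastCases_castSucc j

/-- `subst` on `x_{r+2}`. [folklore] -/
@[simp]
theorem subst_last : subst k r (Fin.last (r + 2)) = C Polynomial.X * X (Fin.last (r + 1)) :=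
  Fin.lastCases_last

/-- The values of `subst` are homogeneous of degree `1`. [folklore] -/
theorem isHomogeneous_subst (i : Fin (r + 3)) : (subst k r i).IsHomogeneous 1 := by
  refine Fin.lastCases ?_ (fun j => ?_) i
  · rw [subst_last]
    simpa using (isHomogeneous_C _ (Polynomial.X : Polynomial k)).mul
      (isHomogeneous_X (Polynomial k) (Fin.last (r + 1)))
  · rw [subst_castSucc]
    exact isHomogeneous_X _ _

/-- The `A`-linear substitution `Ψ_A : A[x₀, …, x_{r+2}] → A[x₀, …, x_{r+1}]`, `x_{r+2} ↦ t x_{r+1}`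
(the quotient map by `(x_{r+2} - t x_{r+1})`). [folklore] -/
def algHomA : MvPolynomial (Fin (r + 3)) (Polynomial k) →ₐ[Polynomial k]
    MvPolynomial (Fin (r + 2)) (Polynomial k) :=
  aeval (subst k r)

/-- `Ψ_A` on variables. [folklore] -/
@[simp]
theorem algHomA_X (i : Fin (r + 3)) : algHomA k r (X i) = subst k r i :=
  aeval_X _ _

/-- `Ψ_A` is a retraction of `A[x₀, …, x_{r+1}] ⊆ A[x₀, …, x_{r+2}]`. [folklore] -/
theorem algHomA_rename_castSucc (p : MvPolynomial (Fin (r + 2)) (Polynomial k)) :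
    algHomA k r (rename Fin.castSucc p) = p := by
  rw [algHomA, aeval_rename]
  have : (subst k r ∘ Fin.castSucc) = X := by
    ext j : 1
    simp
  rw [this, aeval_X_left, AlgHom.id_apply]

/-- `Ψ_A` is surjective. [folklore] -/
theorem algHomA_surjective : Function.Surjective (algHomA k r) :=
  Function.RightInverse.surjective (algHomA_rename_castSucc k r)

/-- `Ψ_A` as a homomorphism of graded rings (total degree). [folklore] -/
def gradedA : 𝒜A' →+*ᵍ 𝒜A where
  __ := (algHomA k r).toRingHom
  map_mem {i x} hx := by
    rw [mem_homogeneousSubmodule] at hx ⊢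
    simpa [algHomA] using hx.aeval (subst k r) (isHomogeneous_subst k r)

/-- Unfolding `gradedA`. [folklore] -/
theorem gradedA_apply (p : MvPolynomial (Fin (r + 3)) (Polynomial k)) :
    gradedA k r p = algHomA k r p := rfl

/-- `gradedA` is surjective. [folklore] -/
theorem gradedA_surjective : Function.Surjective (gradedA k r) :=
  algHomA_surjective k r

/-- The hypothesis of `Proj.map` for `Ψ_A`: the irrelevant ideal `(x₀, …, x_{r+1})` of
`A[x₀, …, x_{r+1}]` is generated by the images `x_j = Ψ_A(x_j)`. [folklore] -/
theorem irrelevant_le_map_gradedA :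
    HomogeneousIdeal.irrelevant 𝒜A ≤ (HomogeneousIdeal.irrelevant 𝒜A').map (gradedA k r) := by
  intro p hp
  have h1 := Motives.Segre.irrelevant_le_span_X (Fin (r + 2)) (Polynomial k) hp
  change p ∈ Ideal.map (gradedA k r) (HomogeneousIdeal.irrelevant 𝒜A').toIdeal
  refine (Ideal.span_le.mpr ?_) h1
  rintro _ ⟨j, rfl⟩
  have : (X j : MvPolynomial (Fin (r + 2)) (Polynomial k)) = gradedA k r (X (Fin.castSucc j)) := by
    rw [gradedA_apply, algHomA_X, subst_castSucc]
  rw [SetLike.mem_coe, this]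
  exact Ideal.mem_map_of_mem _
    (HomogeneousIdeal.mem_irrelevant_of_mem _ Nat.one_pos (isHomogeneous_X (Polynomial k) _))

/-- **`Ψ : k[x₀, …, x_{r+2}] → A[x₀, …, x_{r+1}]`**, `x_j ↦ x_j` (`j ≤ r + 1`),
`x_{r+2} ↦ t · x_{r+1}`, constants along `k ⊆ A = k[t]`: the composite of the coefficient
extension `k[x] → A[x]` (`Motives.ProjBaseChangeRing.mapGraded`) with `Ψ_A`. [folklore] -/
def graded : 𝒜k →+*ᵍ 𝒜A :=
  (gradedA k r).comp (Motives.ProjBaseChangeRing.mapGraded k (Polynomial k) (Fin (r + 3)))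

/-- `Ψ` on variables. [folklore] -/
@[simp]
theorem graded_X (i : Fin (r + 3)) : graded k r (X i) = subst k r i := by
  rw [graded, GradedRingHom.comp_apply, Motives.ProjBaseChangeRing.mapGraded_apply, map_X,
    gradedA_apply, algHomA_X]

/-- `Ψ` on constants. [folklore] -/
@[simp]
theorem graded_C (c : k) : graded k r (C c) = C (Polynomial.C c) := by
  rw [graded, GradedRingHom.comp_apply, Motives.ProjBaseChangeRing.mapGraded_apply, map_C,
    gradedA_apply, Polynomial.algebraMap_eq, algHomA, algHom_C, MvPolynomial.algebraMap_eq]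

/-- The hypothesis of `Proj.map` for `Ψ`. [folklore] -/
theorem irrelevant_le_map_graded :
    HomogeneousIdeal.irrelevant 𝒜A ≤ (HomogeneousIdeal.irrelevant 𝒜k).map (graded k r) :=
  HomogeneousIdeal.irrelevant_le_map_comp
    (Motives.ProjBaseChangeRing.irrelevant_le_map k (Polynomial k) (Fin (r + 3)))
    (irrelevant_le_map_gradedA k r)

/-- **The closed immersion `φ_A : ℙ^{r+1}_A → ℙ^{r+2}_A` onto `V₊(x_{r+2} - t x_{r+1})`**
(`Proj Ψ_A`). [folklore] -/
def embA : Proj 𝒜A ⟶ Proj 𝒜A' :=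
  Proj.map (gradedA k r) (irrelevant_le_map_gradedA k r)

/-- `φ_A` is a closed immersion (`isClosedImmersion_projMap_of_surjective`).
[cite: Hartshorne1977, II Ex. 3.12 (a)] -/
instance isClosedImmersion_embA : IsClosedImmersion (embA k r) :=
  isClosedImmersion_projMap_of_surjective _ _ (gradedA_surjective k r)

/-- The base-change projection `ℙ^{r+2}_A → ℙ^{r+2}_k` (`Proj` of `k[x] → A[x]`; the target is
`(Motives.projectiveSpace (r + 2) k).left` by `rfl`). [folklore] -/
def baseChange : Proj 𝒜A' ⟶ Proj 𝒜k :=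
  Proj.map (Motives.ProjBaseChangeRing.mapGraded k (Polynomial k) (Fin (r + 3)))
    (Motives.ProjBaseChangeRing.irrelevant_le_map k (Polynomial k) (Fin (r + 3)))

/-- **The pencil `ψ : P_A = ℙ^{r+1}_A → ℙ^{r+2}_k`** (`Proj Ψ`; the target is
`(Motives.projectiveSpace (r + 2) k).left` by `rfl`): over `t ∈ 𝔸¹` it is the hyperplane
`H_t = V₊(x_{r+2} - t x_{r+1})`. [folklore] -/
def map : Proj 𝒜A ⟶ Proj 𝒜k :=
  Proj.map (graded k r) (irrelevant_le_map_graded k r)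

/-- `ψ = φ_A ≫ (ℙ^{r+2}_A → ℙ^{r+2}_k)` (Mathlib `Proj.map_comp`). [folklore] -/
theorem map_eq_comp : map k r = embA k r ≫ baseChange k r :=
  Proj.map_comp _ _ _ _

/-! ### Compatibility with the structure morphisms -/

/-- On the chart `D₊(s)`: `Ψ_A` is `A`-linear, i.e. `A → (A[x₀,…,x_{r+2}]_s)₀ → (A[x₀,…,x_{r+1}]_{Ψ_A s})₀`
is the structure map. [folklore] -/
theorem away_map_gradedA_comp_algebraMap (s : MvPolynomial (Fin (r + 3)) (Polynomial k)) :
    (Away.map (gradedA k r) s).comp (algebraMap (Polynomial k) (Away 𝒜A' s)) =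
      (algebraMap (Polynomial k) (Away 𝒜A (gradedA k r s)) : Polynomial k →+* _) := by
  refine RingHom.ext fun a => ?_
  apply val_injective
  rw [RingHom.comp_apply, Motives.ProjBaseChange.val_algebraMap,
    Motives.ProjBaseChange.algebraMap_eq', Away.map, HomogeneousLocalization.map_mk, val_mk,
    ← Localization.mk_algebraMap, Localization.mk_eq_mk_iff]
  refine Localization.r_of_eq ?_
  simp only [OneMemClass.coe_one, one_mul]
  change gradedA k r (algebraMap (Polynomial k) (MvPolynomial (Fin (r + 3)) (Polynomial k)) a) =
    gradedA k r 1 * algebraMap (Polynomial k) (MvPolynomial (Fin (r + 2)) (Polynomial k)) a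
  rw [map_one, one_mul, MvPolynomial.algebraMap_eq, MvPolynomial.algebraMap_eq, gradedA_apply,
    algHom_C, MvPolynomial.algebraMap_eq]

/-- `φ_A` is a morphism over `Spec A`. [folklore] -/
theorem embA_comp_projToSpec :
    embA k r ≫ Motives.ProjBaseChangeRing.projToSpec (Fin (r + 3)) (Polynomial k) =
      Motives.ProjBaseChangeRing.projToSpec (Fin (r + 2)) (Polynomial k) := by
  refine (Proj.mapAffineOpenCover _ (irrelevant_le_map_gradedA k r)).openCover.hom_ext _ _ ?_
  rintro ⟨i, ⟨s, hs⟩⟩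
  have hi : 0 < (i : ℕ) := i.2
  change Proj.awayι 𝒜A (gradedA k r s) ((gradedA k r).2 hs) hi ≫ Proj.map (gradedA k r) _ ≫
      Motives.ProjBaseChangeRing.projToSpec (Fin (r + 3)) (Polynomial k) =
    Proj.awayι 𝒜A (gradedA k r s) ((gradedA k r).2 hs) hi ≫
      Motives.ProjBaseChangeRing.projToSpec (Fin (r + 2)) (Polynomial k)
  rw [Proj.awayι_comp_map_assoc _ _ hi _ hs, Motives.ProjBaseChangeRing.awayι_projToSpec _ hs hi,
    Motives.ProjBaseChangeRing.awayι_projToSpec _ (Graded.map_mem (gradedA k r) hs) hi,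
    ← Spec.map_comp, ← CommRingCat.ofHom_comp, away_map_gradedA_comp_algebraMap]

/-- On the chart `D₊(s)`: `Ψ` is `k`-linear, i.e. `k → (k[x]_s)₀ → (A[x]_{Ψ s})₀` is
`k → A → (A[x]_{Ψ s})₀`. [folklore] -/
theorem away_map_graded_comp_algebraMap (s : MvPolynomial (Fin (r + 3)) k) :
    (Away.map (graded k r) s).comp (algebraMap k (Away 𝒜k s)) =
      (algebraMap (Polynomial k) (Away 𝒜A (graded k r s)) : Polynomial k →+* _).comp
        (algebraMap k (Polynomial k)) := by
  refine RingHom.ext fun a => ?_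
  apply val_injective
  rw [RingHom.comp_apply, RingHom.comp_apply, Motives.ProjBaseChange.val_algebraMap,
    Motives.ProjBaseChange.algebraMap_eq', Away.map, HomogeneousLocalization.map_mk, val_mk,
    ← Localization.mk_algebraMap, Localization.mk_eq_mk_iff]
  refine Localization.r_of_eq ?_
  simp only [OneMemClass.coe_one, one_mul]
  change graded k r (algebraMap k (MvPolynomial (Fin (r + 3)) k) a) =
    graded k r 1 * algebraMap (Polynomial k) (MvPolynomial (Fin (r + 2)) (Polynomial k))
      (algebraMap k (Polynomial k) a)
  rw [map_one, one_mul, MvPolynomial.algebraMap_eq, MvPolynomial.algebraMap_eq, graded_C,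
    Polynomial.algebraMap_eq]

/-- **The pencil is a morphism over `Spec k`**: `ψ ≫ (ℙ^{r+2}_k → Spec k) = (P_A → Spec A) ≫
(Spec A → Spec k)`. [folklore] -/
theorem map_comp_projToSpec :
    map k r ≫ Motives.ProjBaseChangeRing.projToSpec (Fin (r + 3)) k =
      Motives.ProjBaseChangeRing.projToSpec (Fin (r + 2)) (Polynomial k) ≫
        Spec.map (CommRingCat.ofHom (algebraMap k (Polynomial k))) := by
  refine (Proj.mapAffineOpenCover _ (irrelevant_le_map_graded k r)).openCover.hom_ext _ _ ?_
  rintro ⟨i, ⟨s, hs⟩⟩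
  have hi : 0 < (i : ℕ) := i.2
  change Proj.awayι 𝒜A (graded k r s) ((graded k r).2 hs) hi ≫ Proj.map (graded k r) _ ≫
      Motives.ProjBaseChangeRing.projToSpec (Fin (r + 3)) k =
    Proj.awayι 𝒜A (graded k r s) ((graded k r).2 hs) hi ≫
      Motives.ProjBaseChangeRing.projToSpec (Fin (r + 2)) (Polynomial k) ≫
        Spec.map (CommRingCat.ofHom (algebraMap k (Polynomial k)))
  rw [Proj.awayι_comp_map_assoc _ _ hi _ hs, Motives.ProjBaseChangeRing.awayι_projToSpec _ hs hi,
    ← Category.assoc,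
    Motives.ProjBaseChangeRing.awayι_projToSpec _ (Graded.map_mem (graded k r) hs) hi,
    ← Spec.map_comp, ← Spec.map_comp, ← CommRingCat.ofHom_comp, ← CommRingCat.ofHom_comp,
    away_map_graded_comp_algebraMap]

/-! ### The special fibre `t = 0` -/

/-- The reduction `t ↦ 0` of coefficients `A[x₀, …, x_{r+1}] → k[x₀, …, x_{r+1}]` as a graded
ring homomorphism. [folklore] -/
def reduce : 𝒜A →+*ᵍ 𝒜k' where
  __ := MvPolynomial.map (Polynomial.constantCoeff : Polynomial k →+* k)
  map_mem hx := hx.map _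

/-- Unfolding `reduce`. [folklore] -/
theorem reduce_apply (p : MvPolynomial (Fin (r + 2)) (Polynomial k)) :
    reduce k r p = MvPolynomial.map (Polynomial.constantCoeff : Polynomial k →+* k) p := rfl

/-- `reduce ∘ (k[x] → A[x]) = id`. [folklore] -/
theorem reduce_comp_mapGraded :
    (reduce k r).comp (Motives.ProjBaseChangeRing.mapGraded k (Polynomial k) (Fin (r + 2))) =
      GradedRingHom.id _ := by
  apply GradedRingHom.coe_ringHom_injective
  refine MvPolynomial.ringHom_ext (fun c => ?_) (fun i => ?_)
  · change reduce k r (Motives.ProjBaseChangeRing.mapGraded k (Polynomial k) (Fin (r + 2)) (C c)) =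
      C c
    rw [Motives.ProjBaseChangeRing.mapGraded_apply, map_C, reduce_apply, map_C,
      Polynomial.algebraMap_eq, Polynomial.constantCoeff_apply, Polynomial.coeff_C_zero]
  · change reduce k r (Motives.ProjBaseChangeRing.mapGraded k (Polynomial k) (Fin (r + 2)) (X i)) =
      X i
    rw [Motives.ProjBaseChangeRing.mapGraded_apply, map_X, reduce_apply, map_X]

/-- `reduce ∘ Ψ` is the map killing the last variable (`ProjectiveSpace.killLast`):
`x_{r+2} ↦ t x_{r+1} ↦ 0`. [folklore] -/
theorem reduce_comp_graded : (reduce k r).comp (graded k r) = ProjectiveSpace.killLast k (r + 1) := by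
  apply GradedRingHom.coe_ringHom_injective
  refine MvPolynomial.ringHom_ext (fun c => ?_) (fun i => ?_)
  · change reduce k r (graded k r (C c)) = ProjectiveSpace.killLastAlgHom k (r + 1) (C c)
    rw [graded_C, reduce_apply, map_C, Polynomial.constantCoeff_apply, Polynomial.coeff_C_zero,
      algHom_C, MvPolynomial.algebraMap_eq]
  · change reduce k r (graded k r (X i)) = ProjectiveSpace.killLastAlgHom k (r + 1) (X i)
    rw [graded_X, reduce_apply]
    induction i using Fin.lastCases with
    | last =>
      rw [subst_last, map_mul, map_C, map_X, Polynomial.constantCoeff_apply,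
        Polynomial.coeff_X_zero, C_0, zero_mul, ProjectiveSpace.killLastAlgHom_X_last]
    | cast j => rw [subst_castSucc, map_X, ProjectiveSpace.killLastAlgHom_X_castSucc]

/-- The hypothesis of `Proj.map` for `reduce` (both irrelevant ideals are generated by the
variables). [folklore] -/
theorem irrelevant_le_map_reduce :
    HomogeneousIdeal.irrelevant 𝒜k' ≤ (HomogeneousIdeal.irrelevant 𝒜A).map (reduce k r) := by
  intro p hp
  have h1 := Motives.Segre.irrelevant_le_span_X (Fin (r + 2)) k hp
  change p ∈ Ideal.map (reduce k r) (HomogeneousIdeal.irrelevant 𝒜A).toIdeal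
  refine (Ideal.span_le.mpr ?_) h1
  rintro _ ⟨j, rfl⟩
  have : (X j : MvPolynomial (Fin (r + 2)) k) = reduce k r (X j) := by
    rw [reduce_apply, map_X]
  rw [SetLike.mem_coe, this]
  exact Ideal.mem_map_of_mem _
    (HomogeneousIdeal.mem_irrelevant_of_mem _ Nat.one_pos (isHomogeneous_X (Polynomial k) _))

/-- **The special fibre `ρ : ℙ^{r+1}_k → P_A = ℙ^{r+1}_A` at `t = 0`** (`Proj` of the reduction
`t ↦ 0` of coefficients; the source is `(Motives.projectiveSpace (r + 1) k).left` by `rfl`).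
[folklore] -/
def specialFibre : Proj 𝒜k' ⟶ Proj 𝒜A :=
  Proj.map (reduce k r) (irrelevant_le_map_reduce k r)

/-- **On the fibre `t = 0` the pencil is the coordinate hyperplane**:
`ρ ≫ ψ = ProjectiveSpace.hyperplaneEmb k (r + 1)` (both are `Proj` of `x_{r+2} ↦ 0`).
[folklore] -/
theorem specialFibre_comp_map :
    specialFibre k r ≫ map k r = ProjectiveSpace.hyperplaneEmb k (r + 1) :=
  (Proj.map_comp (graded k r) (reduce k r) (irrelevant_le_map_graded k r)
      (irrelevant_le_map_reduce k r)).symm.trans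
    (projMap_congr (reduce_comp_graded k r) _ (ProjectiveSpace.irrelevant_le_map_killLast k (r + 1)))

/-- `ρ` is a section of the base-change projection `P_A → ℙ^{r+1}_k`. [folklore] -/
theorem specialFibre_comp_baseChange :
    specialFibre k r ≫
        Proj.map (Motives.ProjBaseChangeRing.mapGraded k (Polynomial k) (Fin (r + 2)))
          (Motives.ProjBaseChangeRing.irrelevant_le_map k (Polynomial k) (Fin (r + 2))) =
      𝟙 _ := by
  refine (Proj.map_comp (Motives.ProjBaseChangeRing.mapGraded k (Polynomial k) (Fin (r + 2)))
    (reduce k r) (Motives.ProjBaseChangeRing.irrelevant_le_map k (Polynomial k) (Fin (r + 2)))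
    (irrelevant_le_map_reduce k r)).symm.trans ?_
  rw [projMap_congr (reduce_comp_mapGraded k r) _ (by simp)]
  exact Proj.map_id

/-- On the chart `D₊(s)`, `Proj` of the reduction of coefficients commutes with the structure
morphisms: the ring homomorphisms `A → (A[x]_s)₀ → (k[x]_s)₀` and `A → k → (k[x]_s)₀` agree.
[folklore] -/
theorem away_map_reduce_comp_algebraMap (s : MvPolynomial (Fin (r + 2)) (Polynomial k)) :
    (Away.map (reduce k r) s).comp (algebraMap (Polynomial k) (Away 𝒜A s)) =
      (algebraMap k (Away 𝒜k' (reduce k r s))).comp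
        (Polynomial.constantCoeff : Polynomial k →+* k) := by
  refine RingHom.ext fun a => ?_
  apply val_injective
  rw [RingHom.comp_apply, RingHom.comp_apply, Motives.ProjBaseChange.val_algebraMap,
    Motives.ProjBaseChange.algebraMap_eq', Away.map, HomogeneousLocalization.map_mk, val_mk,
    ← Localization.mk_algebraMap, Localization.mk_eq_mk_iff]
  refine Localization.r_of_eq ?_
  simp only [OneMemClass.coe_one, one_mul]
  change reduce k r (algebraMap (Polynomial k) (MvPolynomial (Fin (r + 2)) (Polynomial k)) a) =
    reduce k r 1 * algebraMap k (MvPolynomial (Fin (r + 2)) k) (Polynomial.constantCoeff a)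
  rw [map_one, one_mul, MvPolynomial.algebraMap_eq, MvPolynomial.algebraMap_eq, reduce_apply,
    map_C]

/-- `ρ` commutes with the structure morphisms: `ρ ≫ (P_A → Spec A) = (ℙ^{r+1}_k → Spec k) ≫
Spec (t ↦ 0)`. [folklore] -/
theorem specialFibre_comp_projToSpec :
    specialFibre k r ≫ Motives.ProjBaseChangeRing.projToSpec (Fin (r + 2)) (Polynomial k) =
      Motives.ProjBaseChangeRing.projToSpec (Fin (r + 2)) k ≫
        Spec.map (CommRingCat.ofHom (Polynomial.constantCoeff : Polynomial k →+* k)) := by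
  refine (Proj.mapAffineOpenCover _ (irrelevant_le_map_reduce k r)).openCover.hom_ext _ _ ?_
  rintro ⟨i, ⟨s, hs⟩⟩
  have hi : 0 < (i : ℕ) := i.2
  change Proj.awayι 𝒜k' (reduce k r s) ((reduce k r).2 hs) hi ≫ Proj.map (reduce k r) _ ≫
      Motives.ProjBaseChangeRing.projToSpec (Fin (r + 2)) (Polynomial k) =
    Proj.awayι 𝒜k' (reduce k r s) ((reduce k r).2 hs) hi ≫
      Motives.ProjBaseChangeRing.projToSpec (Fin (r + 2)) k ≫
        Spec.map (CommRingCat.ofHom (Polynomial.constantCoeff : Polynomial k →+* k))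
  rw [Proj.awayι_comp_map_assoc _ _ hi _ hs, Motives.ProjBaseChangeRing.awayι_projToSpec _ hs hi,
    ← Category.assoc, Motives.ProjBaseChangeRing.awayι_projToSpec _ (Graded.map_mem (reduce k r) hs) hi,
    ← Spec.map_comp,
    ← Spec.map_comp, ← CommRingCat.ofHom_comp, ← CommRingCat.ofHom_comp,
    away_map_reduce_comp_algebraMap]

/-- **The special fibre of `P_A → Spec A` at `t = 0` is `ℙ^{r+1}_k`**: the square
`(ρ, ℙ^{r+1}_k → Spec k, P_A → Spec A, Spec k → Spec A)` is cartesian. Proof: pasted with the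
cartesian base-change square for the flat `k → A = k[t]`
(`Motives.ProjBaseChangeRing.isPullback_projMap`) it gives the outer square with both horizontal
edges identities (`ρ` is a section of `P_A → ℙ^{r+1}_k`, and `k → A → k` is the identity), which is
cartesian; so the left square is (`IsPullback.of_right`). [folklore] -/
theorem isPullback_specialFibre :
    IsPullback (specialFibre k r) (Motives.ProjBaseChangeRing.projToSpec (Fin (r + 2)) k)
      (Motives.ProjBaseChangeRing.projToSpec (Fin (r + 2)) (Polynomial k))
      (Spec.map (CommRingCat.ofHom (Polynomial.constantCoeff : Polynomial k →+* k))) := by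
  refine IsPullback.of_right ?_ (specialFibre_comp_projToSpec k r)
    (Motives.ProjBaseChangeRing.isPullback_projMap k (Polynomial k) (Fin (r + 2)))
  have h2 : Spec.map (CommRingCat.ofHom (Polynomial.constantCoeff : Polynomial k →+* k)) ≫
      Spec.map (CommRingCat.ofHom (algebraMap k (Polynomial k))) = 𝟙 _ := by
    rw [← Spec.map_comp, ← CommRingCat.ofHom_comp,
      show (Polynomial.constantCoeff : Polynomial k →+* k).comp (algebraMap k (Polynomial k)) =
        RingHom.id k from RingHom.ext fun c => by simp, CommRingCat.ofHom_id, Spec.map_id]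
  rw [specialFibre_comp_baseChange, h2]
  exact IsPullback.of_horiz_isIso ⟨by simp⟩

/-! ### The chart `D₊(x_{r+1})`: the pencil is an isomorphism onto `D₊(x_{r+1}) ⊆ ℙ^{r+2}_k` -/

/-- The pivot variable `x_{r+1}` of `k[x₀, …, x_{r+2}]`. [folklore] -/
abbrev piv : Fin (r + 3) := Fin.castSucc (Fin.last (r + 1))

/-- `Ψ (x_{r+1}) = x_{r+1}`. [folklore] -/
theorem graded_X_piv : graded k r (X (piv r)) = X (Fin.last (r + 1)) := by
  rw [graded_X]
  exact subst_castSucc k r _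

/-- `x_{r+1} ∈ k[x₀, …, x_{r+2}]` is homogeneous of degree `1`. [folklore] -/
theorem X_piv_mem : (X (piv r) : MvPolynomial (Fin (r + 3)) k) ∈ 𝒜k 1 := isHomogeneous_X k _

/-- `Ψ(x_{r+1})` is homogeneous of degree `1`. [folklore] -/
theorem graded_X_piv_mem : graded k r (X (piv r)) ∈ 𝒜A 1 := (graded k r).2 (X_piv_mem k r)

/-- The change of affine coordinates `k[y₀, …, y_{r+1}] ≃ k[t][y₀, …, y_r]`, `y_j ↦ y_j` (`j ≤ r`),
`y_{r+1} ↦ t` (Mathlib `MvPolynomial.optionEquivRight` after reindexing `Fin (r + 2) ≃ Option (Fin (r + 1))`).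
[folklore] -/
def chartEquiv : MvPolynomial (Fin (r + 2)) k ≃ₐ[k] MvPolynomial (Fin (r + 1)) (Polynomial k) :=
  (renameEquiv k finSuccEquivLast).trans (optionEquivRight k (Fin (r + 1)))

/-- `chartEquiv` on `y_j`, `j ≤ r`. [folklore] -/
@[simp]
theorem chartEquiv_X_castSucc (j : Fin (r + 1)) : chartEquiv k r (X (Fin.castSucc j)) = X j := by
  simp only [chartEquiv, AlgEquiv.trans_apply, renameEquiv_apply, rename_X,
    finSuccEquivLast_castSucc, optionEquivRight_X_some]

/-- `chartEquiv` on `y_{r+1}`. [folklore] -/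
@[simp]
theorem chartEquiv_X_last : chartEquiv k r (X (Fin.last (r + 1))) = C Polynomial.X := by
  simp only [chartEquiv, AlgEquiv.trans_apply, renameEquiv_apply, rename_X,
    finSuccEquivLast_last, optionEquivRight_X_none]

/-- `chartEquiv` on constants. [folklore] -/
@[simp]
theorem chartEquiv_C (c : k) : chartEquiv k r (C c) = C (Polynomial.C c) := by
  simp only [chartEquiv, AlgEquiv.trans_apply, renameEquiv_apply, rename_C, optionEquivRight_C]

/-- The chart map `(k[x]_{x_{r+1}})₀ → (A[x]_{Ψ x_{r+1}})₀ → (A[x]_{x_{r+1}})₀` induced by `Ψ`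
(Mathlib `HomogeneousLocalization.Away.map`, followed by the transport along
`Ψ x_{r+1} = x_{r+1}`). [folklore] -/
def awayMap' : Away 𝒜k (X (piv r) : MvPolynomial (Fin (r + 3)) k) →+*
    Away 𝒜A (X (Fin.last (r + 1)) : MvPolynomial (Fin (r + 2)) (Polynomial k)) :=
  (awayCongr 𝒜A (graded_X_piv k r)).comp
    (Away.map (graded k r) (X (piv r) : MvPolynomial (Fin (r + 3)) k))

/-- `val` of the constants `t / 1 ∈ (A[x]_s)₀`, `t ∈ A = k[t]`. [folklore] -/
theorem val_algebraMap_away (s : MvPolynomial (Fin (r + 2)) (Polynomial k)) (t : Polynomial k) :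
    ((algebraMap (Polynomial k) (Away 𝒜A s) : Polynomial k →+* Away 𝒜A s) t).val =
      Localization.mk (C t) 1 := by
  rw [Motives.ProjBaseChange.val_algebraMap, ← Localization.mk_algebraMap]
  rfl

/-- `Ψ` maps the powers of `x_{r+1}` to powers of `x_{r+1}`. [folklore] -/
theorem graded_den_mem
    (c : NumDenSameDeg 𝒜k (Submonoid.powers (X (piv r) : MvPolynomial (Fin (r + 3)) k))) :
    graded k r (c.den : MvPolynomial (Fin (r + 3)) k) ∈
      Submonoid.powers (X (Fin.last (r + 1)) : MvPolynomial (Fin (r + 2)) (Polynomial k)) := by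
  obtain ⟨n, hn⟩ := c.den_mem
  refine ⟨n, ?_⟩
  beta_reduce at hn ⊢
  rw [← graded_X_piv, ← map_pow, hn]

/-- `val` of `awayMap'` on a fraction (unfolding, `rfl`). [folklore] -/
theorem val_awayMap'_mk
    (c : NumDenSameDeg 𝒜k (Submonoid.powers (X (piv r) : MvPolynomial (Fin (r + 3)) k))) :
    (awayMap' k r (HomogeneousLocalization.mk c)).val =
      Localization.mk (graded k r (c.num : MvPolynomial (Fin (r + 3)) k))
        ⟨graded k r (c.den : MvPolynomial (Fin (r + 3)) k), graded_den_mem k r c⟩ :=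
  rfl

/-- `val` of `awayMap'` on a fraction `x / x_{r+1}^n` (unfolding, `rfl`). [folklore] -/
theorem val_awayMap'_awayMk {d : ℕ} (hs : (X (piv r) : MvPolynomial (Fin (r + 3)) k) ∈ 𝒜k d) (n : ℕ)
    (x : MvPolynomial (Fin (r + 3)) k) (hx : x ∈ 𝒜k (n • d)) :
    (awayMap' k r (Away.mk 𝒜k hs n x hx)).val =
      Localization.mk (graded k r x)
        ⟨graded k r ((X (piv r) : MvPolynomial (Fin (r + 3)) k) ^ n),
          (Submonoid.mem_powers_iff _ _).mpr ⟨n, by rw [map_pow, graded_X_piv]⟩⟩ :=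
  rfl

/-- `awayMap'` on constants `c ∈ k`: `c / 1 ↦ c / 1`. [folklore] -/
theorem awayMap'_algebraMap (c : k) :
    awayMap' k r (algebraMap k _ c) =
      (algebraMap (Polynomial k)
        (Away 𝒜A (X (Fin.last (r + 1)) : MvPolynomial (Fin (r + 2)) (Polynomial k))) :
          Polynomial k →+* _) (Polynomial.C c) := by
  apply val_injective
  rw [Motives.ProjBaseChange.algebraMap_eq', val_awayMap'_mk, val_algebraMap_away,
    Localization.mk_eq_mk_iff]
  refine Localization.r_of_eq ?_
  change (1 : MvPolynomial (Fin (r + 2)) (Polynomial k)) *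
      graded k r (algebraMap k (MvPolynomial (Fin (r + 3)) k) c) =
    graded k r 1 * C (Polynomial.C c)
  rw [map_one, one_mul, one_mul, MvPolynomial.algebraMap_eq, graded_C]

/-- `awayMap'` on the chart generators `x_j / x_{r+1}`, `j ≤ r`: `↦ x_j / x_{r+1}`. [folklore] -/
theorem awayMap'_chartGen_castSucc (j : Fin (r + 1)) :
    awayMap' k r (Motives.ProjectiveSpace.chartGen k (piv r) (Fin.castSucc j)) =
      Motives.ProjectiveSpace.chartGen (Polynomial k) (Fin.last (r + 1)) j := by
  apply val_injective
  rw [Motives.ProjectiveSpace.chartGen, val_awayMap'_awayMk, Motives.ProjectiveSpace.chartGen,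
    Away.val_mk, Localization.mk_eq_mk_iff]
  refine Localization.r_of_eq ?_
  change (X (Fin.last (r + 1)) : MvPolynomial (Fin (r + 2)) (Polynomial k)) ^ 1 *
      graded k r (X ((piv r).succAbove (Fin.castSucc j))) =
    graded k r ((X (piv r) : MvPolynomial (Fin (r + 3)) k) ^ 1) * X ((Fin.last (r + 1)).succAbove j)
  rw [map_pow, graded_X_piv, Fin.succAbove_castSucc_of_lt _ _ (Fin.castSucc_lt_last j), graded_X,
    subst_castSucc, Fin.succAbove_last]

/-- `awayMap'` on the chart generator `x_{r+2} / x_{r+1}`: `↦ t x_{r+1} / x_{r+1} = t`. [folklore] -/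
theorem awayMap'_chartGen_last :
    awayMap' k r (Motives.ProjectiveSpace.chartGen k (piv r) (Fin.last (r + 1))) =
      (algebraMap (Polynomial k)
        (Away 𝒜A (X (Fin.last (r + 1)) : MvPolynomial (Fin (r + 2)) (Polynomial k))) :
          Polynomial k →+* _) Polynomial.X := by
  apply val_injective
  rw [Motives.ProjectiveSpace.chartGen, val_awayMap'_awayMk, val_algebraMap_away,
    Localization.mk_eq_mk_iff]
  refine Localization.r_of_eq ?_
  change (1 : MvPolynomial (Fin (r + 2)) (Polynomial k)) *
      graded k r (X ((piv r).succAbove (Fin.last (r + 1)))) =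
    graded k r ((X (piv r) : MvPolynomial (Fin (r + 3)) k) ^ 1) * C Polynomial.X
  rw [one_mul, map_pow, graded_X_piv, pow_one, Fin.succAbove_castSucc_of_le _ _ le_rfl,
    Fin.succ_last, graded_X, subst_last, mul_comm]

/-- **In the coordinates of the charts `awayMap'` is `chartEquiv`**: the square of ring maps
`k[y₀, …, y_{r+1}] → (k[x]_{x_{r+1}})₀ → (A[x]_{x_{r+1}})₀` and
`k[y₀, …, y_{r+1}] → A[y₀, …, y_r] → (A[x]_{x_{r+1}})₀` (charts
`Motives.ProjectiveSpace.chartAlgEquiv`, Hartshorne II Prop. 2.5 (b)) commutes.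
[cite: Hartshorne1977, II Prop. 2.5 (b)] -/
theorem awayMap'_comp_chart :
    (awayMap' k r).comp
        ((Motives.ProjectiveSpace.chartAlgEquiv k (n := r + 2) (piv r)).symm :
          MvPolynomial (Fin (r + 2)) k →+* Away 𝒜k (X (piv r) : MvPolynomial (Fin (r + 3)) k)) =
      ((Motives.ProjectiveSpace.chartAlgEquiv (Polynomial k) (n := r + 1) (Fin.last (r + 1))).symm :
          MvPolynomial (Fin (r + 1)) (Polynomial k) →+*
            Away 𝒜A (X (Fin.last (r + 1)) : MvPolynomial (Fin (r + 2)) (Polynomial k))).comp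
        (chartEquiv k r : MvPolynomial (Fin (r + 2)) k →+* MvPolynomial (Fin (r + 1)) (Polynomial k)) := by
  refine MvPolynomial.ringHom_ext (fun c => ?_) (fun j => ?_)
  · simp only [RingHom.comp_apply, RingHom.coe_coe, chartEquiv_C]
    rw [← MvPolynomial.algebraMap_eq, ← MvPolynomial.algebraMap_eq]
    change awayMap' k r ((Motives.ProjectiveSpace.chartAlgEquiv k (n := r + 2) (piv r)).symm
        (algebraMap k _ c)) =
      (Motives.ProjectiveSpace.chartAlgEquiv (Polynomial k) (n := r + 1) (Fin.last (r + 1))).symm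
        ((algebraMap (Polynomial k) (MvPolynomial (Fin (r + 1)) (Polynomial k)) :
          Polynomial k →+* _) (Polynomial.C c))
    rw [AlgEquiv.commutes, AlgEquiv.commutes, awayMap'_algebraMap]
  · simp only [RingHom.comp_apply, RingHom.coe_coe, Motives.ProjectiveSpace.chartAlgEquiv_symm_X]
    induction j using Fin.lastCases with
    | last =>
      rw [awayMap'_chartGen_last, chartEquiv_X_last, ← MvPolynomial.algebraMap_eq]
      exact ((Motives.ProjectiveSpace.chartAlgEquiv (Polynomial k) (n := r + 1)
        (Fin.last (r + 1))).symm.commutes Polynomial.X).symm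
    | cast j =>
      rw [awayMap'_chartGen_castSucc, chartEquiv_X_castSucc,
        Motives.ProjectiveSpace.chartAlgEquiv_symm_X]

/-- `awayMap'` is bijective (it is `chartEquiv` in coordinates). [folklore] -/
theorem awayMap'_bijective : Function.Bijective (awayMap' k r) := by
  have hfun : (awayMap' k r : _ → _) =
      (Motives.ProjectiveSpace.chartAlgEquiv (Polynomial k) (n := r + 1) (Fin.last (r + 1))).symm ∘
        chartEquiv k r ∘ Motives.ProjectiveSpace.chartAlgEquiv k (n := r + 2) (piv r) := by
    funext x
    have h := DFunLike.congr_fun (awayMap'_comp_chart k r)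
      (Motives.ProjectiveSpace.chartAlgEquiv k (n := r + 2) (piv r) x)
    simp only [RingHom.comp_apply, RingHom.coe_coe, AlgEquiv.symm_apply_apply] at h
    exact h
  rw [hfun]
  exact (AlgEquiv.bijective _).comp ((chartEquiv k r).bijective.comp (AlgEquiv.bijective _))

/-- **Over `D₊(x_{r+1})` the pencil is an isomorphism of charts**: the ring homomorphism
`(k[x₀, …, x_{r+2}]_{x_{r+1}})₀ → (A[x₀, …, x_{r+1}]_{x_{r+1}})₀` induced by `Ψ` is bijective —
in the coordinates `y_j = x_j / x_{r+1}` of the charts (`Motives.ProjectiveSpace.chartAlgEquiv`,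
Hartshorne II Prop. 2.5 (b)) it is `k[y₀, …, y_r, y_{r+1}] → k[t][y₀, …, y_r]`, `y_{r+1} ↦ t`
(`chartEquiv`). [cite: Hartshorne1977, II Prop. 2.5 (b)] -/
theorem away_map_bijective :
    Function.Bijective (Away.map (graded k r) (X (piv r) : MvPolynomial (Fin (r + 3)) k)) := by
  have hb := awayMap'_bijective k r
  have hc := awayCongr_bijective 𝒜A (graded_X_piv k r)
  refine ⟨fun x y hxy => hb.1 ?_, fun y => ?_⟩
  · change awayCongr 𝒜A (graded_X_piv k r) _ = awayCongr 𝒜A (graded_X_piv k r) _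
    rw [hxy]
  · obtain ⟨x, hx⟩ := hb.2 (awayCongr 𝒜A (graded_X_piv k r) y)
    exact ⟨x, hc.1 hx⟩

/-- **The pencil restricted to the chart `D₊(Ψ x_{r+1}) = D₊(x_{r+1}) ⊆ P_A` is an open immersion
into `ℙ^{r+2}_k`** (an isomorphism onto `D₊(x_{r+1})`: Mathlib `Proj.awayι_comp_map` and
`away_map_bijective`). [folklore] -/
theorem isOpenImmersion_awayι_comp_map :
    IsOpenImmersion (Proj.awayι 𝒜A (graded k r (X (piv r))) (graded_X_piv_mem k r) Nat.one_pos ≫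
      map k r) := by
  have e := Proj.awayι_comp_map (graded k r) (irrelevant_le_map_graded k r) Nat.one_pos _
    (X_piv_mem k r)
  haveI : IsIso (CommRingCat.ofHom (Away.map (graded k r) (X (piv r) : MvPolynomial (Fin (r + 3)) k))) :=
    (ConcreteCategory.isIso_iff_bijective _).mpr (away_map_bijective k r)
  have h : IsOpenImmersion (Spec.map (CommRingCat.ofHom
      (Away.map (graded k r) (X (piv r) : MvPolynomial (Fin (r + 3)) k))) ≫
        Proj.awayι 𝒜k (X (piv r)) (X_piv_mem k r) Nat.one_pos) := inferInstance
  rw [← e] at h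
  exact h

/-- Its image is the chart `D₊(x_{r+1}) ⊆ ℙ^{r+2}_k`. [folklore] -/
theorem range_awayι_comp_map :
    Set.range (Proj.awayι 𝒜A (graded k r (X (piv r))) (graded_X_piv_mem k r) Nat.one_pos ≫
      map k r) = (Proj.basicOpen 𝒜k (X (piv r)) : Set (Proj 𝒜k)) := by
  have e := Proj.awayι_comp_map (graded k r) (irrelevant_le_map_graded k r) Nat.one_pos _
    (X_piv_mem k r)
  haveI : IsIso (CommRingCat.ofHom (Away.map (graded k r) (X (piv r) : MvPolynomial (Fin (r + 3)) k))) :=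
    (ConcreteCategory.isIso_iff_bijective _).mpr (away_map_bijective k r)
  have h : Set.range (Spec.map (CommRingCat.ofHom
      (Away.map (graded k r) (X (piv r) : MvPolynomial (Fin (r + 3)) k))) ≫
        Proj.awayι 𝒜k (X (piv r)) (X_piv_mem k r) Nat.one_pos) =
      (Proj.basicOpen 𝒜k (X (piv r)) : Set (Proj 𝒜k)) := by
    rw [← Scheme.Hom.coe_opensRange, Scheme.Hom.opensRange_comp_of_isIso, Proj.opensRange_awayι]
  rw [← e] at h
  exact h

/-- The image of the chart `D₊(Ψ x_{r+1})` of `P_A` is the preimage of `D₊(x_{r+1})` under the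
pencil. [folklore] -/
theorem range_awayι :
    Set.range (Proj.awayι 𝒜A (graded k r (X (piv r))) (graded_X_piv_mem k r) Nat.one_pos) =
      (map k r ⁻¹ᵁ Proj.basicOpen 𝒜k (X (piv r)) : Set (Proj 𝒜A)) := by
  rw [← Scheme.Hom.coe_opensRange, Proj.opensRange_awayι]
  rfl

end HyperplanePencil

end Literature.AlgebraicGeometry.FundamentalGroup

end
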